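import Summits.QuantumAdvantage.QuantumAdvantage.Theses.CubicForrelation
import Literature.Computability.QuantumComplexity.CubicForrelationEstimatorAnalysis

/-!
# Line `pauli-ct-overlap` for crux `CubicForrelation.CubicForrelationInPrBPP` (stmt-QuantumAdvantage-2204)

Skeleton status: **CLOSED — 0 stubs, 0 sorries.** The composition theorem
`CubicForrelationInPrBPP_of` below proves the crux outright from the landed Literature theorem
`Literature.Computability.QuantumComplexity.CubicDequant.cubicKForrelationProblem_two_mem_PromiseBPP'`
(`Literature/Computability/QuantumComplexity/CubicForrelationEstimatorAnalysis.lean:636`, p72496,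
accepted 2026-08-16T00:36Z; machine `CubicForrelationEstimatorMachine.lean`, identity
`ForrelationDerivativeTables.lean` `DerivativeWalsh.two_pow_mul_forrelation_sq`, exact quadratic
Fourier sampler `QuadraticFourierSampler(Proofs).lean`, Gauss sums `QuadraticWalshGaussSum.lean`).

Why there is nothing to stub. The idea `pauli-ct-overlap` (square the amplitude; expand
`Φ² = 2⁻ⁿ Σ_{h,k} (−1)^{h·k} A_a(h,k) A_b(k,h)` in the Pauli basis; both Pauli spectra of a cubic
phase state are exact quadratic Gauss sums because one derivative of a cubic is quadratic; importance-
sample the expansion with a bounded / second-moment-≤-1 ratio estimator; Chebyshev/Hoeffding; succinct-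
input guard; threshold 0.18) IS the lever of the landed machine (one-sided proposal `∝ T_f(h,·)²`,
`X = T_g(u,h)/T_f(h,u)`, `Σ X = 4ⁿΦ²`, `Σ X² ≤ 4ⁿ`, `N = 128` rounds, threshold `9/50`, guard
`n ≤ |x| + 1`). All three triagers (TRIAGE-r1-1/2/3.md) merged the three surviving ideas
(pauli-ct-overlap ≈ pauli-fidelity-sampling ≈ polarisationproof) into this one line and checked the
one-liner below on the farm (rc 0, axioms {propext, Classical.choice, Quot.sound}). The only content of
pauli-ct-overlap beyond the landed proof — the TWO-sided mixture proposal `P̄ = ½·2⁻ⁿ(A_a² + A_b²)` with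
`|X| ≤ 1` (AM–GM), i.e. Hoeffding instead of Chebyshev constants — is not needed for the crux and is
not an obligation of this line (a ≤ 20-line Literature lemma if anyone ever wants it). Every would-be
stub of the line (Φ²-identity, derivative degree drop, Dickson plateau / exact coset sampling, moment
bounds, guard, Chebyshev wrapper, FP/P-witness of the round) is already a named theorem in the tree, so
filing them as `sorry`-stubs would be pure `line.shredded` (every stub `exact <tree lemma>`).

Disproof used: `Cruxes/CubicForrelationInPrBPP/Disproof.lean` (standing disprover gen-2, tree copy published
2026-08-16T03:48Z; payload.disproof_path's run/gate copy is not mounted in planner jails). FINAL VERDICT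
there: "the crux is a THEOREM of the tree" — its `Disproof.crux_holds` is term-for-term the theorem below,
and `Disproof.crux_iff_mem` (`Iff.rfl`) is the bridge it relies on. There are NO `_false_without_<H>`
theorems (§2: every weakening's negation is a class separation); the proved lattice is honoured by the
landed proof: `cruxWithoutEven_imp_crux` (Even NOT load-bearing — the proof never uses it),
`cruxWithoutDeg_imp_crux` / `not_cruxWithoutDeg_imp_separation` (deg ≤ 3 IS load-bearing — used at
`CubicDequant.Df_quadratic`, quadratic derivatives ⇒ uniform-on-a-coset sampling), `k = 2` (split of Φ²
at the middle Hadamard layer), `cruxWithoutAll_iff_collapse`. §3 refuted strengthenings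
(`signed_slice_defeats_table_deciders`, `forrelation_eq_sign_mul_sign_bias`, `forrelation_mul_cosetBias_eq`;
landed `Theorems/CubicForrelationInPrBPP/Negative/SignedSlice.lean` p69519, `FlatSign.lean` p69828) concern
the SIGNED promise, not this unsigned decider (no-side |Φ| ≤ 1/100 is sign-symmetric); §4
`crux_promise_nondegenerate` (`Negative/NoJunk.lean` p69684) is consistent. No stub exists for a Negative
lemma to refute.

FOR THE LEAD (mode line): this file is already the finished `work/CubicForrelationInPrBPP.lean`.
`lean check --json` it (expect rc 0, sorries 0, audit `CubicForrelationInPrBPP_of` concludes the crux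
BY NAME, closed = true), then land it:
  ledger propose --kind proof \
    --target Summits/QuantumAdvantage/QuantumAdvantage/Theorems/CubicForrelationCubicForrelationInPrBPP.lean \
    --file work/CubicForrelationInPrBPP.lean --workitem stmt-QuantumAdvantage-2204 \
    --note "crux r4 CubicForrelationInPrBPP: one-liner from CubicDequant.cubicKForrelationProblem_two_mem_PromiseBPP' (line pauli-ct-overlap = pauli-fidelity-sampling = polarisationproof)"
and finish `proved:`. (If the Theorems landing prefers the `Theorems` namespace, rename the namespace
below to `Summit.QuantumAdvantage.QuantumAdvantage.Theorems` and the theorem to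
`cubicForrelationInPrBPP_holds`; the statement must stay literally the route decl.)
-/

set_option linter.dupNamespace false

namespace Summit.QuantumAdvantage.QuantumAdvantage.Cruxes.CubicForrelationInPrBPP.PauliCtOverlap

open Literature.Computability.QuantumComplexity

/-- **Composition / closure of the line.** Cubic 2-fold Forrelation (`k = 2`, `n` even, both phase
functions of algebraic degree `≤ 3`; YES `Φ ≥ 3/5`, NO `|Φ| ≤ 1/100`) is in textbook promise-`BPP`
(`PromiseBPP'`): the route decl `CubicForrelation.CubicForrelationInPrBPP` is, by `rfl`
(`cubicKForrelationProblem_two_eq`), the statement `cubicKForrelationProblem 2 ∈ PromiseBPP'`, which is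
the landed theorem `CubicDequant.cubicKForrelationProblem_two_mem_PromiseBPP'` (Pauli/derivative
expansion of `Φ²` + exact quadratic Fourier sampling + Chebyshev over 128 coin blocks + idle-wire guard).
Zero stubs: the skeleton is the proof. -/
theorem CubicForrelationInPrBPP_of :
    Summit.QuantumAdvantage.QuantumAdvantage.Theses.CubicForrelation.CubicForrelationInPrBPP :=
  CubicDequant.cubicKForrelationProblem_two_mem_PromiseBPP'

-- (Equivalently: `by have h := CubicDequant.cubicKForrelationProblem_two_mem_PromiseBPP'; rw [cubicKForrelationProblem_two_eq] at h; exact h`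
--  — checked rc 0 in the planner's folder; kept out of the file so that exactly ONE theorem concludes the crux.)

end Summit.QuantumAdvantage.QuantumAdvantage.Cruxes.CubicForrelationInPrBPP.PauliCtOverlap
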